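import Summits.Ventures.HodgeRepro2.T5SU11ResolventIdentityDecay

/-!
# Positivity of the improper Green's operator and monotonicity of the resolvent in the spectral parameter

For `λ > 1` the improper Green's solution `G^I_λ g = −χ_λ B^I − φ_λ A^I` (row 492) has a kernel of constant sign:
`φ_λ > 0` and `χ_λ > 0` on `(0, ∞)`, so

* `greenBI_nonneg`, `greenAI_nonneg`, **`greenSolI_nonpos`** — for a source `g ≥ 0` on `(0, ∞)`, `B^I, A^I ≥ 0`
  and `G^I_λ g ≤ 0`; symmetrically `greenSolI_nonneg` for `g ≤ 0` (no integrability is needed: the Bochner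
  integral of a nonnegative function is nonnegative);
* `greenSolI_antitone_source` — for `g₁ ≤ g₂` on `(0, ∞)` (both integrable against the basis),
  `G^I_λ g₂ ≤ G^I_λ g₁`: the operator reverses order;
* **`greenSolI_mono_lam`** — on the exponentially decaying class, for a source `g ≥ 0` and `1 < λ₂ ≤ λ`,
  **`G^I_{λ₂} g ≤ G^I_λ g ≤ 0`** (row 500: `G^I_λ g − G^I_{λ₂} g = (μ − μ₂) G^I_λ(G^I_{λ₂} g)` with `μ − μ₂ =
  (λ − λ₂)(λ + λ₂ − 2) ≥ 0` and `G^I_λ` of the nonpositive source `G^I_{λ₂} g` nonnegative), hence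
  `abs_greenSolI_antitone_lam`: `|G^I_λ g| ≤ |G^I_{λ₂} g|` — the resolvent of a nonnegative source decreases in
  absolute value as the spectral parameter moves away from the bottom of the spectrum;
* `iterate_sign` — the iterates `(G^I_{λ₂})^n g` of a nonnegative source alternate in sign: `(−1)^n h_n ≥ 0`.

Nothing is claimed about (N).

Blind lane: Mathlib + the HodgeRepro2 prefix only; no sorry; axioms ⊆ {propext, Classical.choice,
Quot.sound}.
-/

namespace Summit.Ventures.HodgeRepro2.T5SU11ResolventMonotoneDecay

open Filter Topology MeasureTheory
open Set (Ioi Ioc)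
open T5SU11Cartan T5SU11SphericalFunction T5SU11SphericalBounds T5SU11SphericalDecay T5SU11RadialGreenImproper
  T5SU11ResolventIdentityDecay

section measure

variable [MeasurableSpace Circle] [BorelSpace Circle]

variable {lam : ℝ} (hlam : 1 < lam) {g : ℝ → ℝ}

/-- `B^I(t) ≥ 0` for a source `g ≥ 0` on `(0, ∞)`. -/
theorem greenBI_nonneg (hg0 : ∀ s, 0 < s → 0 ≤ g s) (t : ℝ) : 0 ≤ greenBI (fun t => sph lam (hyp t)) g t := by
  unfold greenBI
  apply setIntegral_nonneg measurableSet_Ioc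
  intro s hs
  have hs0 : 0 < s := hs.1
  exact mul_nonneg (mul_nonneg (sph_hyp_pos lam s).le (hg0 s hs0)) (Real.sinh_nonneg_iff.mpr (by linarith))

include hlam in
/-- `A^I(t) ≥ 0` for a source `g ≥ 0` on `(0, ∞)` and `t ≥ 0`. -/
theorem greenAI_nonneg (hg0 : ∀ s, 0 < s → 0 ≤ g s) {t : ℝ} (ht : 0 ≤ t) : 0 ≤ greenAI (sphDecay lam) g t := by
  unfold greenAI
  apply setIntegral_nonneg measurableSet_Ioi
  intro s hs
  have hs0 : 0 < s := lt_of_le_of_lt ht hs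
  exact mul_nonneg (mul_nonneg (sphDecay_pos hlam hs0).le (hg0 s hs0)) (Real.sinh_nonneg_iff.mpr (by linarith))

include hlam in
/-- **`G^I_λ g ≤ 0` on `(0, ∞)` for a source `g ≥ 0`.** -/
theorem greenSolI_nonpos (hg0 : ∀ s, 0 < s → 0 ≤ g s) {t : ℝ} (ht : 0 < t) :
    greenSolI (fun t => sph lam (hyp t)) (sphDecay lam) g t ≤ 0 := by
  unfold greenSolI
  have h1 := mul_nonneg (sphDecay_pos hlam ht).le (greenBI_nonneg (lam := lam) hg0 t)
  have h2 := mul_nonneg (sph_hyp_pos lam t).le (greenAI_nonneg hlam hg0 ht.le)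
  linarith

include hlam in
/-- **`G^I_λ g ≥ 0` on `(0, ∞)` for a source `g ≤ 0`.** -/
theorem greenSolI_nonneg (hg0 : ∀ s, 0 < s → g s ≤ 0) {t : ℝ} (ht : 0 < t) :
    0 ≤ greenSolI (fun t => sph lam (hyp t)) (sphDecay lam) g t := by
  unfold greenSolI greenBI greenAI
  have hB : ∫ s in Ioc 0 t, sph lam (hyp s) * g s * Real.sinh (2 * s) ≤ 0 := by
    apply setIntegral_nonpos measurableSet_Ioc
    intro s hs
    have hs0 : 0 < s := hs.1
    exact mul_nonpos_of_nonpos_of_nonneg (mul_nonpos_of_nonneg_of_nonpos (sph_hyp_pos lam s).le (hg0 s hs0))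
      (Real.sinh_nonneg_iff.mpr (by linarith))
  have hA : ∫ s in Ioi t, sphDecay lam s * g s * Real.sinh (2 * s) ≤ 0 := by
    apply setIntegral_nonpos measurableSet_Ioi
    intro s hs
    have hs0 : 0 < s := lt_trans ht hs
    exact mul_nonpos_of_nonpos_of_nonneg (mul_nonpos_of_nonneg_of_nonpos (sphDecay_pos hlam hs0).le (hg0 s hs0))
      (Real.sinh_nonneg_iff.mpr (by linarith))
  have h1 := mul_nonpos_of_nonneg_of_nonpos (sphDecay_pos hlam ht).le hB
  have h2 := mul_nonpos_of_nonneg_of_nonpos (sph_hyp_pos lam t).le hA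
  linarith

include hlam in
/-- **The operator reverses order**: `g₁ ≤ g₂` on `(0, ∞)` implies `G^I_λ g₂ ≤ G^I_λ g₁` there (both sources
integrable against the basis). -/
theorem greenSolI_antitone_source {g₁ g₂ : ℝ → ℝ} (hle : ∀ s, 0 < s → g₁ s ≤ g₂ s)
    (hB₁ : ∀ T, IntegrableOn (fun s => sph lam (hyp s) * g₁ s * Real.sinh (2 * s)) (Ioc 0 T))
    (hA₁ : IntegrableOn (fun s => sphDecay lam s * g₁ s * Real.sinh (2 * s)) (Ioi 0))
    (hB₂ : ∀ T, IntegrableOn (fun s => sph lam (hyp s) * g₂ s * Real.sinh (2 * s)) (Ioc 0 T))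
    (hA₂ : IntegrableOn (fun s => sphDecay lam s * g₂ s * Real.sinh (2 * s)) (Ioi 0))
    {t : ℝ} (ht : 0 < t) :
    greenSolI (fun t => sph lam (hyp t)) (sphDecay lam) g₂ t ≤ greenSolI (fun t => sph lam (hyp t)) (sphDecay lam) g₁ t := by
  unfold greenSolI
  have hB : greenBI (fun t => sph lam (hyp t)) g₁ t ≤ greenBI (fun t => sph lam (hyp t)) g₂ t := by
    unfold greenBI
    apply setIntegral_mono_on (hB₁ t) (hB₂ t) measurableSet_Ioc
    intro s hs
    have hs0 : 0 < s := hs.1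
    exact mul_le_mul_of_nonneg_right (mul_le_mul_of_nonneg_left (hle s hs0) (sph_hyp_pos lam s).le)
      (Real.sinh_nonneg_iff.mpr (by linarith))
  have hA : greenAI (sphDecay lam) g₁ t ≤ greenAI (sphDecay lam) g₂ t := by
    unfold greenAI
    apply setIntegral_mono_on (hA₁.mono_set (Set.Ioi_subset_Ioi ht.le)) (hA₂.mono_set (Set.Ioi_subset_Ioi ht.le))
      measurableSet_Ioi
    intro s hs
    have hs0 : 0 < s := lt_trans ht hs
    exact mul_le_mul_of_nonneg_right (mul_le_mul_of_nonneg_left (hle s hs0) (sphDecay_pos hlam hs0).le)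
      (Real.sinh_nonneg_iff.mpr (by linarith))
  have h1 := mul_le_mul_of_nonneg_left hB (sphDecay_pos hlam ht).le
  have h2 := mul_le_mul_of_nonneg_left hA (sph_hyp_pos lam t).le
  linarith

variable {lam₂ : ℝ} (hlam₂ : 1 < lam₂) (hg : ContinuousOn g (Ioi 0))
  {M : ℝ} (hM : ∀ s ∈ Ioc (0 : ℝ) 1, |g s| ≤ M) (hM0 : 0 ≤ M)
  {ε C s₀ : ℝ} (hε : 2 - lam < ε) (hε₂ : 2 - lam₂ < ε) (hC : ∀ s, s₀ ≤ s → |g s| ≤ C * Real.exp (-ε * s))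

include hlam hlam₂ hg hM hM0 hε hε₂ hC in
/-- **MONOTONICITY OF THE RESOLVENT IN THE SPECTRAL PARAMETER**: for a source `g ≥ 0` of the exponentially
decaying class and `1 < λ₂ ≤ λ`, `G^I_{λ₂} g ≤ G^I_λ g ≤ 0` on `(0, ∞)`. -/
theorem greenSolI_mono_lam (hle : lam₂ ≤ lam) (hg0 : ∀ s, 0 < s → 0 ≤ g s) {t : ℝ} (ht : 0 < t) :
    greenSolI (fun t => sph lam₂ (hyp t)) (sphDecay lam₂) g t
      ≤ greenSolI (fun t => sph lam (hyp t)) (sphDecay lam) g t ∧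
    greenSolI (fun t => sph lam (hyp t)) (sphDecay lam) g t ≤ 0 := by
  refine ⟨?_, greenSolI_nonpos hlam hg0 ht⟩
  have h := greenSolI_sub_greenSolI_eq hlam hlam₂ hg hM hM0 hε hε₂ hC ht
  have hκ : 0 ≤ lam * (lam - 2) - lam₂ * (lam₂ - 2) := by nlinarith
  have hG : 0 ≤ greenSolI (fun t => sph lam (hyp t)) (sphDecay lam)
      (greenSolI (fun t => sph lam₂ (hyp t)) (sphDecay lam₂) g) t :=
    greenSolI_nonneg hlam (fun s hs => greenSolI_nonpos hlam₂ hg0 hs) ht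
  have := mul_nonneg hκ hG
  linarith

include hlam hlam₂ hg hM hM0 hε hε₂ hC in
/-- For a source `g ≥ 0` of the class and `1 < λ₂ ≤ λ`, `|G^I_λ g| ≤ |G^I_{λ₂} g|` on `(0, ∞)`. -/
theorem abs_greenSolI_antitone_lam (hle : lam₂ ≤ lam) (hg0 : ∀ s, 0 < s → 0 ≤ g s) {t : ℝ} (ht : 0 < t) :
    |greenSolI (fun t => sph lam (hyp t)) (sphDecay lam) g t|
      ≤ |greenSolI (fun t => sph lam₂ (hyp t)) (sphDecay lam₂) g t| := by
  obtain ⟨h1, h2⟩ := greenSolI_mono_lam hlam hlam₂ hg hM hM0 hε hε₂ hC hle hg0 ht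
  rw [abs_of_nonpos h2, abs_of_nonpos (le_trans h1 h2)]
  linarith

include hlam₂ in
/-- **The iterates of a nonnegative source alternate in sign**: `(−1)^n (G^I_{λ₂})^n g ≥ 0` on `(0, ∞)`. -/
theorem iterate_sign (hg0 : ∀ s, 0 < s → 0 ≤ g s) (n : ℕ) {t : ℝ} (ht : 0 < t) :
    0 ≤ (-1 : ℝ) ^ n * (greenSolI (fun t => sph lam₂ (hyp t)) (sphDecay lam₂))^[n] g t := by
  induction n generalizing t with
  | zero => simpa using hg0 t ht
  | succ n ih =>
    rw [Function.iterate_succ_apply', pow_succ]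
    rcases Nat.even_or_odd n with hn | hn
    · have hpow : (-1 : ℝ) ^ n = 1 := hn.neg_one_pow
      have hnp : ∀ s, 0 < s → 0 ≤ (greenSolI (fun t => sph lam₂ (hyp t)) (sphDecay lam₂))^[n] g s := by
        intro s hs
        have := ih hs
        rwa [hpow, one_mul] at this
      have := greenSolI_nonpos hlam₂ hnp ht
      rw [hpow]
      linarith
    · have hpow : (-1 : ℝ) ^ n = -1 := hn.neg_one_pow
      have hnp : ∀ s, 0 < s → (greenSolI (fun t => sph lam₂ (hyp t)) (sphDecay lam₂))^[n] g s ≤ 0 := by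
        intro s hs
        have := ih hs
        rw [hpow] at this
        linarith
      have := greenSolI_nonneg hlam₂ hnp ht
      rw [hpow]
      linarith

end measure

end Summit.Ventures.HodgeRepro2.T5SU11ResolventMonotoneDecay
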